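import Summits.BirchSwinnertonDyer.BirchSwinnertonDyer.Theorems.KatoDescentPotSupersingularReducibleUpperOfCoreInputs
import Summits.BirchSwinnertonDyer.BirchSwinnertonDyer.Theorems.KatoDescentPotSupersingularReducibleFineSelmerRationalTorsion
import Literature.NumberTheory.EllipticCurves.Rank1Residual.CyclotomicBorelLineIsogenyTransport
import HarnessLib

/-!
# Crux M's member inequality and U₀-red's upper half ON THE CYCLOTOMIC-BOREL ROWS (e.g. a rational `3`-torsion point)
# WITHOUT Ferrero–Washington: per row, from Kato's two facts, modularity, GZK (and Cassels for the transport to `W`)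

Seat `bsd-potss-rkm` g35 (prover; cell `bsd-potss`), item stmt-BirchSwinnertonDyer-19196 `ReducibleKatoMember` = crux M of
the routes K9 / K8-t′, with U₀-red (19190 / 19203) as the downstream node (`--supports 19196 --as helper`; route-free; closes
nothing).  HONEST FRAMING (cell): BSD is not proved by any of this; nothing is booked; the CLASS-WIDE statements M / U₀-red
keep their trust base {modularity, Fine, H2X⁺, FW}; this file proves their PER-ROW conclusions on an explicit sub-class with
FW removed.

THE POINT.  Crux M's chain reads Coates–Sujatha's (A) at KATO'S MEMBER `W_K` (the curve produced by the hull package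
`exists_memberHullZetaFineInputs`), which is only known up to `ℚ`-isogeny.  This seat's g35 files give (A) FACT-FREE at a curve
carrying a rational line of `E[p]` fixed pointwise by `Gal(ℚ̄/ℚ(μ_p))` (`p ∤ h(ℚ(μ_p))`), and the Literature file
`Rank1Residual/CyclotomicBorelLineIsogenyTransport` (this seat) shows that this condition PASSES ALONG EVERY `ℚ`-ISOGENY
(Weil pairing).  Hence on every row whose listed curve `W` carries such a line — in particular every `W` with a rational point
of order `p` — the per-row conclusions of M and U₀-red follow from {`exists_isNewformOf`, GZK, `exists_memberHullZetaFineInputs`,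
`exists_iwasawaH2Data_fineSelmerDual_embedding_count`} (+ Cassels `bsdRHS_eq_of_isIsogenous` and `hasEntireLFunction_rat` for
the bookkeeping back to `W`), with NO Ferrero–Washington, NO Lim, NO char-form fact, NO Imai, NO class number (p = 3, 5, 7):

* `katoMemberShaBoundSharp_of_fineInputs_of_cyclotomicBorel` — the SHARP member inequality
  `ord_p #Ш(W')[p^∞] + v_p Tam(W') ≤ ord_p(L(W',1)/Ω(W')) + 2·ord_p #W'(ℚ)_tors` at Kato's member `W' ∼ W`, for `W` globally
  minimal, `p` odd additive potentially good, `L(W,1) ≠ 0`, `Ш(W)` finite, `W[p] ⊇ Φ` a rational line fixed by `Gal(ℚ̄/L)`,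
  `L ⊆ ℚ̄` `p`-th cyclotomic with `p ∤ #Cl(𝓞 L)` (the proof of `ReducibleUpperOfCoreInputs.katoMemberShaBoundSharp_of_coreInputs`
  with the class-wide core package replaced by Fine + H2X⁺ + the transported FW-free (A) + g33's per-pin assembly).
* `missingUpperBoundAt_of_fineInputs_of_cyclotomicBorel` — U₀-red's `MissingUpperBoundAt W p` at `r_an = 0` on the same rows.
* `missingUpperBoundAt_three_of_fixed_point` / `…_five_…` — **`MissingUpperBoundAt W 3` (resp. `5`) for every globally minimal
  `W/ℚ` with additive potentially good reduction at `3` (resp. `5`), analytic rank `0`, and a rational point of order `3`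
  (resp. `5`) (a non-zero `Γ_ℚ`-fixed point of `W[p]`), from {modularity, GZK, Cassels, entire `L`, Fine, H2X⁺} ONLY.**
  Census (HOME/rkm/g35): 4865 of the 9476 K9 O6 X3 `r_an = 0` classes contain such a curve at `p = 3`.

References: [Kato2004Asterisque] Thm. 12.5 (pp. 221–222), §14.14 (p. 243), Prop. 14.16 (2) (pp. 244–245); [CoatesSujatha2005]
Cor. 3.6; [Greenberg2001IwasawaPastPresent] p. 342; [SilvermanAEC2009] Prop. III.8.1; [Cassels1965ArithmeticVIII].
-/

-- the summit and its single problem are both named `BirchSwinnertonDyer` (registry layout D-0017)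
set_option linter.dupNamespace false
set_option autoImplicit false

noncomputable section

open scoped Classical ContRepresentation NumberField TensorProduct
open CategoryTheory Function Field NumberField IsDedekindDomain WeierstrassCurve CongruenceSubgroup
open Literature.NumberTheory.EllipticCurves Literature.NumberTheory.GaloisRepresentations
  Literature.NumberTheory.GaloisRepresentations.DiscreteGaloisModule Literature.NumberTheory.GaloisCohomology
open Literature.NumberTheory.EllipticCurves.ModularForms Literature.NumberTheory.EllipticCurves.GreenbergSelmer
open Literature.NumberTheory.EllipticCurves.Kato2004 Literature.NumberTheory.EllipticCurves.Kato2004.EulerSystemValues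
open Literature.NumberTheory.EllipticCurves.IwasawaAlgebra Rat.HeightOneSpectrum
open Literature.NumberTheory.EllipticCurves.Rank1Residual Literature.NumberTheory.EllipticCurves.Rank1Residual.Typed
open Summit.BirchSwinnertonDyer.Rank1Residual.X11b.Levels Summit.BirchSwinnertonDyer.Rank1Residual.X11b.LocBridge
  Summit.BirchSwinnertonDyer.Rank1Residual.X11b.AcSelmer
open Summit.BirchSwinnertonDyer.Rank1Residual Summit.BirchSwinnertonDyer.Rank1Residual.Additive
open Summit.BirchSwinnertonDyer.BirchSwinnertonDyer.Theorems
open Summit.BirchSwinnertonDyer.BirchSwinnertonDyer.Theorems.ASideJunction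
open Summit.BirchSwinnertonDyer.BirchSwinnertonDyer.Theorems.KatoFiniteLevelCount
open Summit.BirchSwinnertonDyer.BirchSwinnertonDyer.Theorems.StrictSelmerBridge
open Summit.BirchSwinnertonDyer.BirchSwinnertonDyer.Theorems.IntegralH1LayerZeroTop
open Summit.BirchSwinnertonDyer.BirchSwinnertonDyer.Theorems.MemberIndexOfValue
open Summit.BirchSwinnertonDyer.BirchSwinnertonDyer.Theorems.MemberHullZetaInputsOfCore
open Summit.BirchSwinnertonDyer.BirchSwinnertonDyer.Theorems.ReducibleUpperOfCoreInputs

namespace Summit.BirchSwinnertonDyer.BirchSwinnertonDyer.Theorems.ReducibleUpperCyclotomicBorel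

/-! ## §1 The sharp member inequality at Kato's member, per row, on the cyclotomic-Borel rows — no FW -/

/-- **THE SHARP MEMBER BOUND on a cyclotomic-Borel row from Kato's two facts, modularity and GZK — NO Ferrero–Washington.**
For `W/ℚ` globally minimal, `p ≠ 2` additive potentially good, `L(W,1) ≠ 0`, `Ш(W)` finite, and a rational line `Φ ≤ W[p]`
fixed pointwise by `Gal(ℚ̄/L)` (`L ⊆ ℚ̄` a `p`-th cyclotomic field with `p ∤ #Cl(𝓞 L)`): Kato's member `W' ∼ W` satisfies
`ord_p #Ш(W')[p^∞] + v_p Tam(W') ≤ ord_p(L(W',1)/Ω(W')) + 2·ord_p #W'(ℚ)_tors`.  Proof = `katoMemberShaBoundSharp_of_coreInputs`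
with the core package REBUILT per row: Fine's hull data `Z` at `W'`, H2X⁺'s `(J, e_X, count)` at `W'` (Imai's finiteness is the
tree theorem `finite_fixedPoints_kerSubgroup_inf_decomp_of_padicValRat_j_nonneg`), statement (A) at `W'` FACT-FREE
(`ReducibleFineSelmerRationalTorsion.fineSelmerDual_moduleFinite_of_forall_mem_fixingSubgroup_smul_eq` on the line TRANSPORTED
to `W'` by `exists_isRationalLine_fixedBy_of_isIsogenous`), g33's assembly `nonempty_coreInputs_of_fineInputs_of_moduleFinite`,
Poitou–Tate over `ℚ` (tree theorem), `sha_add_tamagawa_le_of_PT`.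
[cite: Kato2004Asterisque, Thm. 12.5 (3) (p. 222), §14.14 (p. 243), proof of Prop. 14.16 (pp. 244–245)]
[cite: CoatesSujatha2005, Cor. 3.6] [cite: SilvermanAEC2009, Prop. III.8.1] -/
theorem katoMemberShaBoundSharp_of_fineInputs_of_cyclotomicBorel
    (hmod : exists_isNewformOf) (hGZK : rank_eq_analyticRank_of_analyticRank_le_one)
    (hF : exists_memberHullZetaFineInputs) (hH : exists_iwasawaH2Data_fineSelmerDual_embedding_count)
    (W : WeierstrassCurve ℚ) [W.IsElliptic] [W.IsGloballyMinimal] (p : ℕ) [Fact p.Prime]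
    (hp : p ≠ 2) (hng : ¬ W.HasGoodReductionAtPrime p) (hnm : ¬ W.HasMultiplicativeReductionAtPrime p)
    (hj : 0 ≤ padicValRat p W.j)
    {Φ : AddSubgroup (W.geomTorsion (p : ℤ))} (hΦ : IsRationalLine W p Φ)
    (Lc : IntermediateField ℚ (AlgebraicClosure ℚ)) [IsCyclotomicExtension {p} ℚ Lc]
    (hΦL : ∀ σ : absoluteGaloisGroup ℚ, σ ∈ (Lc.fixingSubgroup : Subgroup (absoluteGaloisGroup ℚ)) →
      ∀ x : W.geomTorsion (p : ℤ), x ∈ Φ → σ • x = x)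
    (hreg : ¬ p ∣ Nat.card (ClassGroup (𝓞 Lc)))
    (hL : W.entireLFunction 1 ≠ 0) (hfin : Finite W.sha) :
    ∃ (W' : WeierstrassCurve ℚ) (_ : W'.IsElliptic) (_ : W'.IsGloballyMinimal),
      IsIsogenous W W' ∧ Finite W'.sha ∧
      ∃ q : ℚ, W'.entireLFunction 1 / (W'.realPeriodRat : ℂ) = (q : ℂ) ∧
        (padicValNat p (Nat.card (AddCommGroup.primaryComponent W'.sha p)) : ℤ) +
            padicValNat p W'.tamagawaProduct ≤
          padicValRat p q + 2 * (padicValNat p W'.torsionOrder : ℤ) := by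
  have hpp : p.Prime := Fact.out
  have hPT : poitouTate_selmerStructure_duality ℚ :=
    poitouTate_selmerStructure_duality_of_conj (InputsPoitouTateSelmer.poitouTate_selmerStructure_duality_conj_holds ℚ)
  have hirr : ¬ W.HasIrreducibleModPGaloisRep p := not_hasIrreducibleModPGaloisRep_of_isRationalLine hΦ
  -- Kato's member `W'` and the hull data at it
  obtain ⟨W', hE', hM', hiso, hrest⟩ := hF W p hp hng hnm hj hirr hL hfin
  haveI := hE'
  haveI := hM'
  haveI : ContinuousSMul ℤ_[p] (W'.tateModule p) := TateModule.continuousSMul_padicInt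
  haveI : Module.Free ℤ_[p] (W'.tateModule p) := W'.module_free_tateModule_holds p
  haveI : Module.Finite ℤ_[p] (W'.tateModule p) := W'.module_finite_tateModule_holds p
  -- `W(ℚ)` finite (GZK at analytic rank `0`), transported along the isogeny; `Ш(W')` finite likewise
  have h0 : W.analyticRank = 0 := by
    by_cases hE : W.HasEntireLFunction
    · exact (WeierstrassCurve.analyticRank_eq_zero_iff_holds (W := W) hE).mpr hL
    · exact W.analyticRank_eq_zero_of_not_hasEntireLFunction hE
  obtain ⟨hrk, -⟩ := hGZK W (by rw [h0]; exact zero_le_one)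
  rw [h0] at hrk
  haveI hWfin : Finite W.toAffine.Point := (W.mordellWeilRank_eq_zero_iff_finite).mp hrk
  haveI hW'fin : Finite W'.toAffine.Point := finite_point_of_isIsogenous hiso.symm_of_isElliptic hWfin
  have hfin' : Finite W'.sha := (IsIsogenous.shaFinite_iff_shaFinite hiso).mp hfin
  haveI : Finite W'.sha := hfin'
  haveI : Finite (AddCommGroup.primaryComponent W'.sha p) := inferInstance
  -- a newform of `W` (modularity) and the zeta-body data of the hull sub-package
  haveI : NeZero (W.conductorNorm ℤ) := ⟨(W.conductorNorm_pos_holds).ne'⟩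
  obtain ⟨f, hf⟩ := hmod W
  obtain ⟨κ', Λ', c, d, a, A, z, x, -, -, -, -, hbody, hall⟩ := hrest f hf (fun m => Classical.arbitrary _)
  -- the cyclotomic `ℤ_p`-tower with a topological generator (PROVED), the pinned `𝐇¹_Γ(T_pW')` (PROVED), the lift `𝐲`
  obtain ⟨κ, hκ, γ, hγ, -⟩ := exists_isCyclotomic_isTopGenerator_isCyclotomicVariable_holds p
  obtain ⟨I⟩ := Kato2004.nonempty_iwasawaH1Data_holds W' p κ γ hκ hγ
  obtain ⟨y, hy⟩ :=
    (IwasawaH1Data.existsUnique_lift_of_zetaBody p W' hκ hp I f _ κ' Λ' c d a A z x hbody).exists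
  obtain ⟨Z⟩ := hall κ γ hκ hγ I y hy
  -- statement (A) AT THE MEMBER, fact-free: the cyclotomic-Borel line passes along `W ∼ W'`
  obtain ⟨Ψ, hΨ, hΨL⟩ := exists_isRationalLine_fixedBy_of_isIsogenous hiso hΦ Lc hΦL
  obtain ⟨h1, h2⟩ := hΨ.ne_bot_and_ne_top
  have hAW' := ReducibleFineSelmerRationalTorsion.fineSelmerDual_moduleFinite_of_forall_mem_fixingSubgroup_smul_eq W' p hp
    κ hκ Ψ hΨ.2 h1 h2 Lc hΨL hreg
  -- H2X⁺ at the member (the finiteness of `W'(ℚ_{p,∞})[p^∞]` is a tree theorem at a potentially good `p`)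
  obtain ⟨φ⟩ := hiso
  have hj' : 0 ≤ padicValRat p W'.j := padicValRat_j_nonneg_of_isogeny φ hpp hj
  let v : HeightOneSpectrum (𝓞 ℚ) := Rat.HeightOneSpectrum.primesEquiv.symm ⟨p, hpp⟩
  have hv : ((Rat.HeightOneSpectrum.primesEquiv v : Nat.Primes) : ℕ) = p := by
    simp only [v, Equiv.apply_symm_apply]
  have hfinI : Finite (FixedPoints.addSubgroup ↥(κ.kerSubgroup ⊓ decomp v) (W'.geomPrimaryTorsion p)) :=
    TowerTorsionFiniteOrdinary.finite_fixedPoints_kerSubgroup_inf_decomp_of_padicValRat_j_nonneg W' p hp hj' κ hκ v hv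
  obtain ⟨J, eX, heX, hcokX, hcnt⟩ := hH W' p κ γ hγ v hp hκ hv hfinI I
  -- the core package per pin, and the sharp member inequality
  obtain ⟨Zc⟩ := FineInputsCharForm.nonempty_coreInputs_of_fineInputs_of_moduleFinite W' p hAW' hγ Z J eX heX hcokX
    (hcnt inferInstance inferInstance)
  exact ⟨W', hE', hM', ⟨φ⟩, hfin', Zc.sha_add_tamagawa_le_of_PT hκ hγ hPT hp⟩

/-! ## §2 U₀-red's upper half per row on the cyclotomic-Borel rows — no FW -/

/-- **U₀-red's `MissingUpperBoundAt W p` at `r_an = 0` on a cyclotomic-Borel row, from {modularity, GZK, Cassels, entire `L`,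
Fine, H2X⁺} — NO Ferrero–Washington** (the proof of `ReducibleUpperOfCoreInputs.missingUpperBoundAt_of_coreInputs` over §1).
[cite: Kato2004Asterisque, proof of Prop. 14.16 (pp. 244–245), §14.14 (p. 243)] [cite: Cassels1965ArithmeticVIII]
[cite: Miller2011LMS, Def. 1.1] -/
theorem missingUpperBoundAt_of_fineInputs_of_cyclotomicBorel
    (hmod : exists_isNewformOf) (hGZK : rank_eq_analyticRank_of_analyticRank_le_one)
    (hCassels : bsdRHS_eq_of_isIsogenous) (hmodL : hasEntireLFunction_rat)
    (hF : exists_memberHullZetaFineInputs) (hH : exists_iwasawaH2Data_fineSelmerDual_embedding_count)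
    (W : WeierstrassCurve ℚ) [W.IsElliptic] [W.IsGloballyMinimal] (p : ℕ) [Fact p.Prime]
    (hp : p ≠ 2) (hng : ¬ W.HasGoodReductionAtPrime p) (hnm : ¬ W.HasMultiplicativeReductionAtPrime p)
    (hj : 0 ≤ padicValRat p W.j)
    {Φ : AddSubgroup (W.geomTorsion (p : ℤ))} (hΦ : IsRationalLine W p Φ)
    (Lc : IntermediateField ℚ (AlgebraicClosure ℚ)) [IsCyclotomicExtension {p} ℚ Lc]
    (hΦL : ∀ σ : absoluteGaloisGroup ℚ, σ ∈ (Lc.fixingSubgroup : Subgroup (absoluteGaloisGroup ℚ)) →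
      ∀ x : W.geomTorsion (p : ℤ), x ∈ Φ → σ • x = x)
    (hreg : ¬ p ∣ Nat.card (ClassGroup (𝓞 Lc)))
    (hr : W.analyticRank = 0) : MissingUpperBoundAt W p := by
  have hL : W.entireLFunction 1 ≠ 0 := (W.analyticRank_eq_zero_iff_holds (hmodL W)).mp hr
  have hfin : Finite W.sha := (hGZK W (by rw [hr]; exact zero_le_one)).2
  obtain ⟨W', hE', hM', hiso, hfin', q, hq, hle⟩ :=
    katoMemberShaBoundSharp_of_fineInputs_of_cyclotomicBorel hmod hGZK hF hH W p hp hng hnm hj hΦ Lc hΦL hreg hL hfin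
  haveI := hE'
  haveI := hM'
  have hr' : W'.analyticRank = 0 := by rw [← analyticRank_eq_of_isIsogenous' hiso, hr]
  obtain ⟨q', hq', hv⟩ := exists_shaAn_eq_of_exactCount W' p hGZK hmodL hr' (b := 0)
    (a := padicValRat p q + 2 * (padicValNat p W'.torsionOrder : ℤ) -
      ((padicValNat p (Nat.card (AddCommGroup.primaryComponent W'.sha p)) : ℤ) +
        padicValNat p W'.tamagawaProduct)) hq (by ring)
  have hup' : MissingUpperBoundAt W' p := ⟨q', hq', by rw [hv]; linarith⟩
  exact TwistComparison.missingUpperBoundAt_of_isIsogenous W' W p hCassels hGZK hmodL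
    hiso.symm_of_isElliptic (by rw [hr']; exact zero_le_one) hup'

/-! ## §3 The rational-`p`-torsion rows at `p = 3, 5`: nothing displayed beyond the held inputs -/

/-- `3 ∤ #Cl(𝓞 L')` for every third cyclotomic extension `L'/ℚ` (`h = 1`, Mathlib `three_pid`), for an abstract field (so that
either `ℚ`-algebra structure on a subfield of `ℚ̄` is served). [cite: Washington1997, §11.5 (class numbers of small cyclotomic fields)] -/
theorem not_dvd_card_classGroup_of_isCyclotomicExtension_three (L' : Type) [Field L'] [NumberField L']
    (h : IsCyclotomicExtension {3} ℚ L') : ¬ 3 ∣ Nat.card (ClassGroup (𝓞 L')) := by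
  rw [Nat.card_eq_fintype_card]
  change ¬ 3 ∣ NumberField.classNumber L'
  rw [Literature.NumberTheory.IwasawaTheory.classNumber_eq_one_of_isCyclotomicExtension_three L']
  decide

/-- `5 ∤ #Cl(𝓞 L')` for every fifth cyclotomic extension `L'/ℚ` (`h = 1`, Mathlib `five_pid`). [cite: Washington1997, §11.5 (class numbers of small cyclotomic fields)] -/
theorem not_dvd_card_classGroup_of_isCyclotomicExtension_five (L' : Type) [Field L'] [NumberField L']
    (h : IsCyclotomicExtension {5} ℚ L') : ¬ 5 ∣ Nat.card (ClassGroup (𝓞 L')) := by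
  rw [Nat.card_eq_fintype_card]
  change ¬ 5 ∣ NumberField.classNumber L'
  rw [Literature.NumberTheory.IwasawaTheory.classNumber_eq_one_of_isCyclotomicExtension_five L']
  decide

/-- **U₀-red's `MissingUpperBoundAt W 3` for every globally minimal `W/ℚ` with additive potentially good reduction at `3`,
analytic rank `0` and a rational point of order `3` (a non-zero `Γ_ℚ`-fixed `Q ∈ W[3](ℚ̄)`), from {modularity, GZK, Cassels,
entire `L`, Fine, H2X⁺} ONLY** — no Ferrero–Washington, no class number (`h(ℚ(μ_3)) = 1`), the line `ℤQ` transported to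
Kato's member. [cite: Kato2004Asterisque, proof of Prop. 14.16 (pp. 244–245)] [cite: CoatesSujatha2005, Cor. 3.6]
[cite: Greenberg2001IwasawaPastPresent, p. 342] -/
theorem missingUpperBoundAt_three_of_fixed_point
    (hmod : exists_isNewformOf) (hGZK : rank_eq_analyticRank_of_analyticRank_le_one)
    (hCassels : bsdRHS_eq_of_isIsogenous) (hmodL : hasEntireLFunction_rat)
    (hF : exists_memberHullZetaFineInputs) (hH : exists_iwasawaH2Data_fineSelmerDual_embedding_count)
    (W : WeierstrassCurve ℚ) [W.IsElliptic] [W.IsGloballyMinimal] [Fact (3 : ℕ).Prime]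
    (hng : ¬ W.HasGoodReductionAtPrime 3) (hnm : ¬ W.HasMultiplicativeReductionAtPrime 3)
    (hj : 0 ≤ padicValRat 3 W.j)
    (Q : W.geomTorsion ((3 : ℕ) : ℤ)) (hQ0 : Q ≠ 0) (hQfix : ∀ σ : absoluteGaloisGroup ℚ, σ • Q = Q)
    (hr : W.analyticRank = 0) : MissingUpperBoundAt W 3 := by
  obtain ⟨L, hL⟩ := WeierstrassCurve.exists_isCyclotomicExtension_intermediateField (K := ℚ) (p := 3)
  haveI hL' : IsCyclotomicExtension {3} ℚ ↥L := ReducibleFineSelmerRationalTorsion.isCyclotomicExtension_rat_transport _ hL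
  haveI : NumberField L := IsCyclotomicExtension.numberField {3} ℚ L
  -- the line `ℤQ` on `W` itself (the identity isogeny), fixed by everything
  obtain ⟨Φ, hΦ, hΦL⟩ := exists_isRationalLine_fixedBy_of_isIsogenous_of_fixed_point
    (⟨Isogeny.id W⟩ : IsIsogenous W W) Q hQ0 hQfix L
  exact missingUpperBoundAt_of_fineInputs_of_cyclotomicBorel hmod hGZK hCassels hmodL hF hH W 3 (by decide) hng hnm hj
    hΦ L hΦL (not_dvd_card_classGroup_of_isCyclotomicExtension_three _ hL') hr

/-- **U₀-red's `MissingUpperBoundAt W 5` for every globally minimal `W/ℚ` with additive potentially good reduction at `5`,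
analytic rank `0` and a rational point of order `5`, from {modularity, GZK, Cassels, entire `L`, Fine, H2X⁺} ONLY.**
[cite: Kato2004Asterisque, proof of Prop. 14.16 (pp. 244–245)] [cite: CoatesSujatha2005, Cor. 3.6]
[cite: Greenberg2001IwasawaPastPresent, p. 342] -/
theorem missingUpperBoundAt_five_of_fixed_point
    (hmod : exists_isNewformOf) (hGZK : rank_eq_analyticRank_of_analyticRank_le_one)
    (hCassels : bsdRHS_eq_of_isIsogenous) (hmodL : hasEntireLFunction_rat)
    (hF : exists_memberHullZetaFineInputs) (hH : exists_iwasawaH2Data_fineSelmerDual_embedding_count)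
    (W : WeierstrassCurve ℚ) [W.IsElliptic] [W.IsGloballyMinimal] [Fact (5 : ℕ).Prime]
    (hng : ¬ W.HasGoodReductionAtPrime 5) (hnm : ¬ W.HasMultiplicativeReductionAtPrime 5)
    (hj : 0 ≤ padicValRat 5 W.j)
    (Q : W.geomTorsion ((5 : ℕ) : ℤ)) (hQ0 : Q ≠ 0) (hQfix : ∀ σ : absoluteGaloisGroup ℚ, σ • Q = Q)
    (hr : W.analyticRank = 0) : MissingUpperBoundAt W 5 := by
  obtain ⟨L, hL⟩ := WeierstrassCurve.exists_isCyclotomicExtension_intermediateField (K := ℚ) (p := 5)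
  haveI hL' : IsCyclotomicExtension {5} ℚ ↥L := ReducibleFineSelmerRationalTorsion.isCyclotomicExtension_rat_transport _ hL
  haveI : NumberField L := IsCyclotomicExtension.numberField {5} ℚ L
  obtain ⟨Φ, hΦ, hΦL⟩ := exists_isRationalLine_fixedBy_of_isIsogenous_of_fixed_point
    (⟨Isogeny.id W⟩ : IsIsogenous W W) Q hQ0 hQfix L
  exact missingUpperBoundAt_of_fineInputs_of_cyclotomicBorel hmod hGZK hCassels hmodL hF hH W 5 (by decide) hng hnm hj
    hΦ L hΦL (not_dvd_card_classGroup_of_isCyclotomicExtension_five _ hL') hr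

end Summit.BirchSwinnertonDyer.BirchSwinnertonDyer.Theorems.ReducibleUpperCyclotomicBorel

end
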